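import Summits.Ventures.QEC.Census.CertBZPlaneSound
import Summits.Ventures.QEC.Census.CertBZInfoSets
import Summits.Ventures.QEC.Census.CertChunks
import Summits.Ventures.QEC.Census.Kernel.TB_g60_A0_2_28_B0_7_38.Cert
import HarnessLib

/-!
# `TB_g60_A0_2_28_B0_7_38` (census row `2bga-g60-A0.2.28-B0.7.38`, `[[120, 4, 14]]`) — lane families, file 10 of 10 (1 `Plane.segOK` / `Plane.seg2OK` theorems, 5495792 lanes; KERNEL)

Families (block, matrix, largest-row segment `[m₀, m₀+s)` / single row / second-row range): (2,1,[59,60)).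

Source certificate `cert/search-8-cand/2bga-g60-A0.2.28-B0.7.38.certA.json` (kernel A, `bz_aut` on the `Z` side, 59 listed translations; sha256 `0dab0a139884f4a1db99647488a152f26e87dc34ab48de9319e3acc557ed4b03`,
`certA=0dab0a139884f4a1` on HOME/STATUS.md; matrix_sha256 `1337983f500d7e3789301ee41e80f8334a89b55ef1fac2eba227956f2554ee19`). The code enters the tree as the explicit CSS code
`TB_g60_A0_2_28_B0_7_38.cert.code _` (`CSSCode.ofMatrices (rowMatrix 120 cert.HX) (rowMatrix 120 cert.HZ)`; 60 `X`-checks, 60 `Z`-checks; bit `q` = gens qubit `q`).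
Lane: `Z` side = qec-type-01's lane-parallel Brouwer–Zimmermann replay (`Census/CertBZPlane*.lean`: one `Plane.segOK … = true` theorem per
largest-row segment, `Plane.reaches_of_segList`, `DistCert.bzZEnum_of_reaches`, `DistCert.bzZBlock_of_parts`; 186102762 lanes in 84 segment theorems),
lower bound by qec-type-12`s explicit-permutation automorphism lane (`Census/BZAutPerm*.lean`: `autGensOK`, `autWordsOK`, `coverAutPermOK`, `bzAut_perm_lower`);
`X` side = qec-type-10's `X ↔ Z` swap (`Census/CertCheckXZSwap.lean` p491526: `xzSwapOK` by `decide +kernel` ⇒ `d_X = d_Z` for THESE matrices, no typed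
code object; the CERT-FORMAT v1.3 (d) `assumes = LemmaXZ` tag of one-sided rows is DISCHARGED in the kernel). Tier KERNEL-std = CERTIFIED: every check
`decide +kernel` or a proof term, axioms ⊆ {propext, Classical.choice, Quot.sound}, NO `native_decide`. HONEST FRAMING: the certificate is DATA
transcribed here and RE-CHECKED by the kernel; nothing printed is used; census row `2bga-g60-A0.2.28-B0.7.38` (cell A.3*; TABLE v64 code_id S8_60_w6_k4_0228B07: tier COMPUTED (certA 0dab0a139884f4a1 = this certificate ∧ certB 76cf2cf29aa3bba7, signed:qec-ref-1) before this file).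
Census KERNEL-UPGRADE lane (director-qec R33, gate5 2026-08-27T05:05:24Z); emitted by `HOME/lean/type-01/kdelta/emit_kernel_row.py` (qec-type-01 g4) —
do not edit by hand, re-emit. Statements name `TB_g60_A0_2_28_B0_7_38.cert` / `TB_g60_A0_2_28_B0_7_38.bzData` explicitly (gate dedup compares statement text across code namespaces).
-/

set_option autoImplicit false
set_option Elab.async false

namespace Summit.Ventures.QEC.Census.TB_g60_A0_2_28_B0_7_38

open Matrix Literature.InformationTheory.QuantumCodes Summit.Ventures.QEC.Census

set_option maxHeartbeats 400000000 in
/-- Block 2, matrix 1, lane segment `[59, 60)` (depth 6, 5495792 lanes): every selection with largest row there has weight `> 13` or is allow-listed (lane engine δ, KERNEL). -/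
theorem psegZ_2_1_22 : Plane.segOK 120 13 (TB_g60_A0_2_28_B0_7_38.cert.sideZ.found.map Prod.fst) (giRows (gbRows TB_g60_A0_2_28_B0_7_38.cert.HZ TB_g60_A0_2_28_B0_7_38.bzData.rcZ TB_g60_A0_2_28_B0_7_38.bzData.LZ TB_g60_A0_2_28_B0_7_38.bzBlockZ2) (TB_g60_A0_2_28_B0_7_38.bzBlockZ2.mats.getD 1 { T := [], A := [], t := 0 })) 6 59 1 2018 = true := by
  decide +kernel

end Summit.Ventures.QEC.Census.TB_g60_A0_2_28_B0_7_38
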